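import Literature.MathematicalPhysics.QuantumFieldTheory.Balaban1983to89.B2Ineq335ZeroFieldConcrete
import Literature.MathematicalPhysics.QuantumFieldTheory.Balaban1983to89.B2Ineq340VectorFields

/-!
# `Balaban1983to89.B2Ineq340ZeroFieldConcrete` — [Balaban1982Higgs2] §3.B pp. 591–592: **(3.40)–(3.41) AT ZERO FIELD ON
THE CONCRETE (Higgs)₂,₃ CARRIER WITH PROPOSITION 3.1 AND THE VECTOR-FIELD (3.35)–(3.38) DISCHARGED** — the schematic
vector-field theorem `B2Ineq340VectorFields.ineq340_core` (this seat, gen 6: (3.22)_v ⇒ ∫Z e^{−¼X}·Πζ″ with bond AND site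
restrictions `χᶜ_{Q_v}`, `χᶜ_{R_v}`) instantiated with the zero-field (3.25) density `Z(0)e^{−½⟨Φ,Δ(0)Φ⟩}` of the concrete
(3.23)/(3.24) carrier (gen 4's `B2Eq325ConcreteSchur`), its Proposition 3.1 input — now INCLUDING the per-site mass terms
`(Lᵏε)^d m²|A_k(x)|²` read by the site restrictions `|A(x)| > p/(μ₀ε)` of (2.2) — supplied by
`B2Prop31ZeroFieldConcrete.prop31_zeroField_concrete` (gen 4, hypothesis-free), the vector-field (3.36)–(3.38) supplied
AS AN EQUALITY (`h336_concrete` + `eq337` + p28's `eq338`), and the bookkeeping `ineq340_of_321_339` ((3.21) + (2.118) +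
(3.39) ⇒ (3.40)): of the five inputs of (3.40) only the scalar-chain ones ((3.21), (2.118), (3.39) under the integral)
remain hypotheses

statement-level skeleton of published theorems with citation tags; proofs where landed; nothing here is a claim about the Yang–Mills mass gap

CITATION HEADER.  T. Bałaban, *(Higgs)₂,₃ quantum fields in a finite volume. II. An upper bound*, Commun. Math. Phys.
**86** (1982) 555–594 [Balaban1982Higgs2] (cell paper B2; PDF held `paper:balaban1982-cmp86-higgs23-ii`, journal page =
PDF page + 554; pp. 588–592 READ AS IMAGES on the ×2 renders
`run/shared/lean/pub/pub-balaban/b2b-balaban-ref1/pages/1982-cmp86-higgs23-II/1982-cmp86-higgs23-II-p034-x2.png` … `-p038-x2.png`,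
(2.2) on `-p003-x2.png`).  Unit `lit-balaban-p15` gen 6 (Phase-2 proof seat p15; HOME `run/shared/lean/pub/lit-balaban/`).
SKELETON rows **B2.Eq3.32** ((3.30)–(3.41), residue member (3.40); fold owner r02, second readers r14/r13, referee ref-4)
and **B2.Prop3.1** (zero-field clause p. 589, with its MASS sum).  USED BY NAME (nothing restated): this seat's
`B2Ineq340VectorFields.{ineq340_core, ineq340_of_321_339}` and `B2Ineq335ZeroFieldConcrete.{KSite, Sites, cfgOf,
measurePreserving_cfgOf, Bnd, bondSet, bondTerm, bondTerm_nonneg, sum_bondSet_zero, sum_bondSet_succ, measurable_form325,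
lintegral_weight4_eq}`, `B2Ineq335Exceptions.rhs322`, `B2Ineq335Printed.{excLevel, largeFieldSite}`, r14's
`B2Eq337LastIntegrations.gaussLevel`; gen 4's `B2Eq337ScalarIntegration.{Regions, Cfg, LSite, F325, eq337, finrank_V}`,
`B2Eq325ConcreteSchur.{form325, Z325, eq325_concrete, Z325_pos}`, `B2Eq328ConcretePieces.{Nested, mass0, resL, mass0_eq_sum}`,
`B2Prop31ZeroFieldConcrete.{massK, gamma0, gamma0_pos, prop31_zeroField_concrete}`, `B2Ineq339Gathering.{vol, vol_nonneg,
h336_concrete}`, p28's `B2Ineq338Diamagnetic.{E0s, eq338}`.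

THE SOURCE TEXT (verbatim, p. 591 l.−9 – p. 592 l.6 [PDF 37–38]).  *"Using the above inequality we estimate the right
side of (3.21) by an expression in which the curly bracket {…} is replaced by the right side of (3.39). The
expression we get can be estimated in a way similar to (3.22). Now it is even simpler because we do not need the
characteristic functions, as it was noticed in Proposition 3.1. We get the inequality ∫dB∫dψ ρ^{(K),L^Kε}(Λ₀⁽⁰⁾, …,
Λ₀⁽ᴷ⁻¹⁾, B, B^{(K),ε}, ψ) ≦ Π_{k=0}^{K−1} ζ″_{Λ₀⁽ᵏ⁾} exp(E₀) exp(O(1)Σ_{k=1}^{K}|Λ_k|) exp(O(1)|T_ε|), (3.40) where ζ″_{Λ₀⁽ᵏ⁾} =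
Σ_{{P_v⁽ᵏ⁾,…,R_s⁽ᵏ⁾} admissible, minimal} exp(−⅛ap(Lᵏε)²|P_v⁽ᵏ⁾|)exp(−¼γ₀p(Lᵏε)²|Q_v⁽ᵏ⁾|)·exp(−¼γ₀p(Lᵏε)²|R_v⁽ᵏ⁾|)
exp(−⅛ap(Lᵏε)²|P_s⁽ᵏ⁾|)·exp(−¼γ₀p(Lᵏε)²|Q_s⁽ᵏ⁾|)exp(−p(Lᵏε)²|R_s⁽ᵏ⁾|). (3.41)"*  Prop. 3.1 p. 589: *"⟨Φ, Δ(Ã^ε)Φ⟩ ≧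
γ₀Σ_{k=0}^{K}Σ_{⟨x,x′⟩⊂Λ₅⁽ᵏ⁻¹⁾′∩Λ₅⁽ᵏ⁾ᶜ}(Lᵏε)^{d−2}|U(Ã^ε(⟨x,x′⟩))φ_k(x′) − φ_k(x)|² + γ₀Σ_{k=0}^{K}Σ_{x∈Λ₅⁽ᵏ⁻¹⁾′∩Λ₅⁽ᵏ⁾ᶜ}(Lᵏε)^d
m²|φ_k(x)|² − Σ_{k=1}^{K}O((Lᵏε)^{κ₀})|(Λ₅⁽ᵏ⁻¹⁾′∩Λ₅⁽ᵏ⁾ᶜ)₁|, (3.26) … If Ã^ε = 0, then the inequality holds without the last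
sum on the right side and without any restrictions on the configuration Φ."*  (2.2) p. 557 (the vector-field
restrictions): *"|B(y) − (QA)(y)| > p(ε), |(∂A)(b)| > p(ε), |A(x)| > p(ε)/(μ₀ε)"* (↦ P_v, Q_v, R_v); (3.36)–(3.38) p. 591
(for the vector fields: *"E₀"* of (3.40) = the free normalization, part I (1.12)–(1.13)); (2.118) p. 582:
*"Σ_{j=0}^{K−1}O(1)(Lʲε)^{κ₀}|T_ε| ≦ O(1)|T_ε|"*.  ((3.21), (3.30)–(3.34), (3.39) are quoted in `B2Ineq340VectorFields` /
`B2Ineq335Exceptions` / `B2Ineq335ZeroFieldConcrete`.)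

THE MODEL.  As in `B2Ineq335ZeroFieldConcrete` (level 0 of r14's chain = the CONCRETE kept configurations on
`KSite R = R.OutSite ⊕ R.BlockSite`, i.e. `Λ₅⁽⁰⁾ᶜ ⊔ ⨆_{k=1}^{K}Λ_k`, transported to gen 4's `Cfg R N` by `cfgOf`; output
levels, centres, large-field indicators `largeFieldSite`, other characteristic functions `b ∈ [0,1]`, family weights
`w` schematic), now READ FOR THE VECTOR FIELDS (`N` components ↤ `N = d`, mass `m²` ↤ `μ₀²`, no background field, no
characteristic functions `χ` of (3.23) needed — the zero-field clause of Prop. 3.1).  NEW and CONCRETE (§1): the mass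
part of (3.26) SITE BY SITE — `siteMass R m² u x = (L^{k(x)}ε)^d m²|u(x)|²` with `k(x) = lvl R x` (`0` on `Λ₅⁽⁰⁾ᶜ`, `j+1`
on `Λ_{j+1}`) and the k-th site set `massSet R k` (`k = 0`: `Λ₅⁽⁰⁾ᶜ`; `k = n+1 ≤ K`: `Λ_{n+1}`), so that the site
restrictions `χᶜ_{R_v⁽ʲ⁾}` (`hlarge'`: `= 1` forces `siteMass > r′_j` on `R_v⁽ʲ⁾ ⊆ massSet R j`, ↤ `|A(x)| > p/(μ₀ε)`) read
the very terms Prop. 3.1 bounds; the bond restrictions `χᶜ_{Q_v⁽ʲ⁾}` read `bondTerm` on `Q_v⁽ʲ⁾ ⊆ bondSet R j` as before;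
`γ₀ = gamma0 P a m²`; NO error terms.

WHAT IS PROVED (kernel-checked, 0 `sorry`, standard axioms).
§1 `lvl`, `siteMass`, `massSet` (defs with bodies), `siteMass_nonneg`, `sum_massSet_zero` (= gen 4's `mass0`),
   `sum_massSet_succ` (= `massK j`), `sum_levels_sites_eq` (bond + site sums over `k ≤ K` = the whole zero-field right
   side of (3.26)), **`h326_zeroField_sites`**: `Σ_{k≤K} γ₀(Σ_{b∈bondSet k}bondTerm + Σ_{x∈massSet k}siteMass) ≤ form325(Φ)`
   for EVERY `Φ` (`prop31_zeroField_concrete`; the `E ≡ 0` instance of the hypothesis `h326` of `ineq340_core`).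
§2 **`ineq340_zeroField`**: `(3.22)_v ≤ ∫dΦ Z(0)e^{−¼⟨Φ,Δ(0)Φ⟩} · Π_{j<K}Σ_τ w_{j,τ}e^{−¼γ₀r_j|Q_v⁽ʲ⁾(τ)|}e^{−¼γ₀r′_j|R_v⁽ʲ⁾(τ)|}
   (e^{−⅛ar_j})^{|P_v⁽ʲ⁾(τ)|}` — the level factor is **ζ″ (3.41)** (with `w` the scalar factors, `r_j = r′_j = p(Lʲε)²`) —
   with NO error factor, for nested region data (`K ≤` the number of scales, `Lᴷε ≤ 1`), `m² > 0`, `a > 0`, `L > 1`, from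
   `hlarge`/`hlarge'` and `4N log 2 ≤ a r_j` alone: Prop. 3.1 (bonds AND masses) DISCHARGED.
§3 **`I4_zeroField_eq`** ((3.36)–(3.38) for the vector fields, EXACT at zero field: `∫dΦ Z(0)e^{−¼⟨Φ,Δ(0)Φ⟩} =
   e^{½N log 2·Σ_{k=0}^{K}vol_k}·e^{E0s P C m²}` — Jacobian of `Φ = √2Φ′`, (3.23)/(3.32) `eq337`, free Gaussian integral
   `eq338`), `vol_zero_le_card` (`|Λ₅⁽⁰⁾ᶜ| ≤ |T_ε|`), **`ineq340_zeroField_knit`**: given the scalar-chain inputs in printed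
   shape — (3.21) `lhs ≤ I_v e^{s₂₁}`, (2.118) `s₂₁ ≤ C₁|T_ε|`, (3.39) under the vector-field integral `I_v ≤
   e^{E_{0,s}}e^{c₃₉Σ_{k=0}^{K}vol_k}·((3.22)_v).toReal` — `lhs ≤ Π_{j<K}ζ″_j · e^{E_{0,s}+E_{0,v}} · e^{(c₃₉+½N log 2)Σ_{k=1}^{K}vol_k} ·
   e^{(C₁+|c₃₉|+|½N log 2|)|T_ε|}` with `E_{0,v} = E0s P C m²` of THIS carrier and `ζ″_j = Σ_τ w_{j,τ}e^{−¼γ₀r_j|Q_v|}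
   e^{−¼γ₀r′_j|R_v|}(e^{−⅛ar_j})^{|P_v|}` (real weights `w ≥ 0`): (3.40) with `E₀ = E_{0,s} + E_{0,v}`, both `O(1)` explicit,
   and its vector-field inputs (§2 of `B2Ineq340VectorFields`: `h335v`, `h3368v`, `hvol0`) SUPPLIED.
HONEST SCOPE.  (i) Zero background field, which IS the printed situation for the vector fields ((3.21): the A-chain
starts from `exp(−½⟨A₀,(−Δ^ε+μ₀²)A₀⟩)`, no `U(Ã)`); the carrier is gen 4's (3.23)/(3.24) Schur-complement carrier read with
`N = d` components — the print's vector-field covariance is component-diagonal `−Δ^ε + μ₀²`, i.e. `U ≡ 1`, which is what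
`form325 R C a 0 m²` is (the charge data `C` enters only through `U(0) = 1`).  (ii) The OUTPUT structure and the
compositions *"similar to (3.22)"* stay schematic exactly as in `B2Ineq340VectorFields` ((3.21) → (3.22)_v-shape is the
dictionary, not constructed); the three scalar-chain inputs of §3 are real-number hypotheses in printed shape (the scalar
(3.39) itself is PROVED at zero field on the concrete carrier in `B2Ineq335ZeroFieldConcrete.ineq339_zeroField`, but under
the vector-field integral it is needed configuration-wise in `B`, hence kept as the hypothesis `h339`).  (iii) `E₀ =
E_{0,s} + E_{0,v}` is this seat's reading of (3.40)'s `exp(E₀)` (part I (1.13)), as in `B2Ineq340VectorFields`.  Value =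
the published vector-field step of §3.B closed on the concrete carrier at zero field; NOT summit progress.
-/

noncomputable section

open MeasureTheory Finset Function Real
open scoped ENNReal BigOperators

namespace Literature.MathematicalPhysics.QuantumFieldTheory.Balaban1983to89.B2Ineq340ZeroFieldConcrete

open Literature.MathematicalPhysics.QuantumFieldTheory.Balaban1983to89.HiggsCovariancePos (Inside)
open Literature.MathematicalPhysics.QuantumFieldTheory.Balaban1983to89.B2Ineq338Diamagnetic
open Literature.MathematicalPhysics.QuantumFieldTheory.Balaban1983to89.B2Eq337ScalarIntegration
open Literature.MathematicalPhysics.QuantumFieldTheory.Balaban1983to89.B2Eq325ConcreteSchur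
open Literature.MathematicalPhysics.QuantumFieldTheory.Balaban1983to89.B2Eq328ConcretePieces
open Literature.MathematicalPhysics.QuantumFieldTheory.Balaban1983to89.B2Eq328DeltaK
open Literature.MathematicalPhysics.QuantumFieldTheory.Balaban1983to89.B2Prop31ZeroFieldConcrete
open Literature.MathematicalPhysics.QuantumFieldTheory.Balaban1983to89.B2Ineq339Gathering
open Literature.MathematicalPhysics.QuantumFieldTheory.Balaban1983to89.B2Eq337LastIntegrations
open Literature.MathematicalPhysics.QuantumFieldTheory.Balaban1983to89.B2Ineq335Exceptions
open Literature.MathematicalPhysics.QuantumFieldTheory.Balaban1983to89.B2Ineq335Printed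
open Literature.MathematicalPhysics.QuantumFieldTheory.Balaban1983to89.B2Ineq335ZeroFieldConcrete
open Literature.MathematicalPhysics.QuantumFieldTheory.Balaban1983to89.B2Ineq340VectorFields

variable {P : HiggsLattice.Params} {N K : ℕ}

/-! ## §1  The mass part of (3.26) SITE BY SITE on the kept variables (for the site restrictions `χᶜ_{R_v}`) -/

section Data

variable (R : Regions P K) (msq : ℝ)

/-- The scale `k` of a kept site (`0` on `Λ₅⁽⁰⁾ᶜ`, `j+1` on `Λ_{j+1}`). [cite: Balaban1982Higgs2, (3.24) p.588] -/
def lvl : KSite R → ℕ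
  | Sum.inl _ => 0
  | Sum.inr s => s.1.val + 1

/-- The mass term of (3.26) at ONE kept site `x` of scale `k`: `(Lᵏε)^d m²|φ_k(x)|²` (↤ for the vector fields `m² = μ₀²`,
the term made large by the restriction `|A(x)| > p/(μ₀ε)` of (2.2)). [cite: Balaban1982Higgs2, Prop. 3.1 (3.26) p.589] -/
def siteMass (u : KSite R → V N) (x : KSite R) : ℝ := P.mesh (lvl R x) ^ P.d * msq * ‖u x‖ ^ 2

/-- The sites of the k-th mass sum of (3.26): `k = 0` ↦ `Λ₅⁽⁰⁾ᶜ`, `k = n+1 ≤ K` ↦ `Λ_{n+1}`, none above.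
[cite: Balaban1982Higgs2, Prop. 3.1 (3.26) p.589] -/
def massSet : ℕ → Finset (KSite R)
  | 0 => (Finset.univ : Finset R.OutSite).map ⟨Sum.inl, Sum.inl_injective⟩
  | n + 1 =>
    if h : n < K then
      (Finset.univ : Finset (LSite R ⟨n, h⟩)).map
        ⟨fun y => Sum.inr ⟨⟨n, h⟩, y⟩, fun y y' hy => by simpa using hy⟩
    else ∅

variable {R msq}

/-- the site masses are non-negative (`m² ≥ 0`). [cite: Balaban1982Higgs2, Prop. 3.1 (3.26) p.589] -/
theorem siteMass_nonneg (hmsq : 0 ≤ msq) (u : KSite R → V N) (x : KSite R) : 0 ≤ siteMass R msq u x :=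
  mul_nonneg (mul_nonneg (pow_nonneg (P.mesh_pos _).le _) hmsq) (sq_nonneg _)

/-- the level-0 mass sum is `mass0` (`mass0_eq_sum`). [cite: Balaban1982Higgs2, Prop. 3.1 (3.26) p.589] -/
theorem sum_massSet_zero (u : KSite R → V N) :
    ∑ x ∈ massSet R 0, siteMass R msq u x = mass0 R msq (cfgOf R u).1 := by
  rw [mass0_eq_sum]
  simp only [massSet, Finset.sum_map, Function.Embedding.coeFn_mk, siteMass, lvl]
  rfl

/-- the level-(j+1) mass sum is `massK j`. [cite: Balaban1982Higgs2, Prop. 3.1 (3.26) p.589] -/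
theorem sum_massSet_succ (u : KSite R → V N) (j : Fin K) :
    ∑ x ∈ massSet R (j.val + 1), siteMass R msq u x = massK R msq j (resL R j (cfgOf R u)) := by
  have hM : massSet R (j.val + 1) = (Finset.univ : Finset (LSite R j)).map
      ⟨fun y => Sum.inr ⟨j, y⟩, fun y y' hy => by simpa using hy⟩ := by
    simp only [massSet, dif_pos j.isLt]
  rw [hM, Finset.sum_map, massK]
  refine Finset.sum_congr rfl fun y _ => ?_
  simp only [Function.Embedding.coeFn_mk, siteMass, lvl]
  rfl

/-- **the right side of (3.26) at zero field with the mass part site by site, summed over `k ≤ K`**, is the pair of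
sums of `prop31_zeroField_concrete`. [cite: Balaban1982Higgs2, Prop. 3.1 (3.26) p.589] -/
theorem sum_levels_sites_eq (C : HiggsLattice.ChargeData N) (γ₀ : ℝ) (u : KSite R → V N) :
    ∑ n ∈ range (K + 1), (γ₀ * (∑ b ∈ bondSet R n, bondTerm R C u b + ∑ x ∈ massSet R n, siteMass R msq u x) - 0)
      = γ₀ * (bond0 R C (0 : HiggsLattice.VecField P 0) (cfgOf R u).1 + ∑ j, bondK R j (resL R j (cfgOf R u)))
        + γ₀ * (mass0 R msq (cfgOf R u).1 + ∑ j, massK R msq j (resL R j (cfgOf R u))) := by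
  simp only [sub_zero]
  rw [Finset.sum_range_succ', ← Fin.sum_univ_eq_sum_range (fun n => γ₀ * (∑ b ∈ bondSet R (n + 1),
    bondTerm R C u b + ∑ x ∈ massSet R (n + 1), siteMass R msq u x)) K]
  have h1 : ∀ j : Fin K, γ₀ * (∑ b ∈ bondSet R (j.val + 1), bondTerm R C u b
      + ∑ x ∈ massSet R (j.val + 1), siteMass R msq u x)
      = γ₀ * bondK R j (resL R j (cfgOf R u)) + γ₀ * massK R msq j (resL R j (cfgOf R u)) := fun j => by
    rw [sum_bondSet_succ, sum_massSet_succ]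
    ring
  simp only [h1, sum_bondSet_zero, sum_massSet_zero, Finset.sum_add_distrib, ← Finset.mul_sum]
  ring

/-- **PROPOSITION 3.1 AT ZERO FIELD, site-by-site mass part, feeds `h326`** (no restriction on `Φ`, no error terms).
[cite: Balaban1982Higgs2, Prop. 3.1 (3.26) p.589] -/
theorem h326_zeroField_sites (C : HiggsLattice.ChargeData N) {a : ℝ} (hR : Nested R) (hK : K ≤ P.K)
    (hε : P.mesh K ≤ 1) (ha : 0 < a) (hL : 1 < P.L) (hmsq : 0 < msq) (u : KSite R → V N) :
    ∑ n ∈ range (K + 1), (gamma0 P a msq * (∑ b ∈ bondSet R n, bondTerm R C u b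
        + ∑ x ∈ massSet R n, siteMass R msq u x) - 0)
      ≤ form325 R C a (0 : HiggsLattice.VecField P 0) msq (cfgOf R u) := by
  rw [sum_levels_sites_eq]
  exact prop31_zeroField_concrete R C hR hK hε ha hL hmsq (cfgOf R u)

end Data

/-! ## §2  The vector-field (3.35) with ζ″ AT ZERO FIELD on the concrete carrier: Prop. 3.1 DISCHARGED -/

section Ineq340Zero

variable (R : Regions P K) (C : HiggsLattice.ChargeData N) {a msq : ℝ}
variable {O : ℕ → Type} [∀ i, Fintype (O i)] [∀ i, DecidableEq (O i)]
variable {ι : Fin K → Type*} [∀ j, Fintype (ι j)]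

/-- **`ineq340_core` AT ZERO FIELD ON THE CONCRETE CARRIER, PROPOSITION 3.1 DISCHARGED**: the vector-field analogue of
(3.35) (families with output exceptions `P_v`, bond restrictions `Q_v` on the CONCRETE bond terms of (3.26) and site
restrictions `R_v` on the CONCRETE site masses `(Lᵏε)^d m²|A_k(x)|²` of (3.26), weights `w` ↤ the scalar factors of
(3.34)) for the zero-field (3.25) density of the concrete (3.23)/(3.24) carrier with `N` components and mass `m²` (↤ the
vector field: `N = d`, `m² = μ₀²`, no background field — *"we do not need the characteristic functions, as it was
noticed in Proposition 3.1"*): `(3.22)_v ≤ ∫dΦ Z(0)e^{−¼⟨Φ,Δ(0)Φ⟩}·Π_{j<K}Σ_τ w_{j,τ}e^{−¼γ₀r_j|Q_v⁽ʲ⁾|}e^{−¼γ₀r′_j|R_v⁽ʲ⁾|}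
(e^{−⅛ar_j})^{|P_v⁽ʲ⁾|}` — the level factor is ζ″ (3.41) — with `γ₀ = gamma0 P a m²`, NO error factor, the (3.26) input being
`prop31_zeroField_concrete` (`h326_zeroField_sites`). [cite: Balaban1982Higgs2, (3.40)–(3.41) pp.591–592, Prop. 3.1 (3.26) p.589] -/
theorem ineq340_zeroField (hR : Nested R) (hK : K ≤ P.K) (hε : P.mesh K ≤ 1) (ha : 0 < a) (hL : 1 < P.L)
    (hmsq : 0 < msq) {s : ℕ → ℝ} (hs : ∀ j, 0 < s j)
    {c : (j : ℕ) → ((i : ℕ) → Sites R O i → V N) → Sites R O (j + 1) → V N} (hc : ∀ j, Measurable (c j))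
    (hcdep : ∀ j i, j + 1 ≤ i → ∀ (x : (i : ℕ) → Sites R O i → V N) (y : Sites R O i → V N),
      c j (update x i y) = c j x)
    {r : ℕ → ℝ} (hr : ∀ j, 4 * (N : ℝ) * Real.log 2 ≤ a * r j) (r' : ℕ → ℝ)
    {b : ((i : ℕ) → Sites R O i → V N) → ℝ} (hb : ∀ x, 0 ≤ b x ∧ b x ≤ 1)
    (w : (j : Fin K) → ι j → ℝ≥0∞) (Q : (j : Fin K) → ι j → Finset (Bnd P)) (hQ : ∀ j τ, Q j τ ⊆ bondSet R j)
    (Rv : (j : Fin K) → ι j → Finset (KSite R)) (hRv : ∀ j τ, Rv j τ ⊆ massSet R j)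
    (Pex : (j : Fin K) → ι j → Finset (Sites R O (j + 1)))
    (χQ χR : (j : Fin K) → ι j → (KSite R → V N) → ℝ) (hχQ : ∀ j τ u, χQ j τ u = 0 ∨ χQ j τ u = 1)
    (hχR : ∀ j τ u, χR j τ u = 0 ∨ χR j τ u = 1)
    (hlarge : ∀ j τ u, χQ j τ u = 1 → ∀ bb ∈ Q j τ, r j < bondTerm R C u bb)
    (hlarge' : ∀ j τ u, χR j τ u = 1 → ∀ xx ∈ Rv j τ, r' j < siteMass R msq u xx)
    (x : (i : ℕ) → Sites R O i → V N) :
    rhs322 (fun i => (volume : Measure (Sites R O i → V N)))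
        (fun u => ENNReal.ofReal (Z325 R C a (0 : HiggsLattice.VecField P 0) msq
          * Real.exp (-(form325 R C a (0 : HiggsLattice.VecField P 0) msq (cfgOf R u) / 2))))
        (fun x => ENNReal.ofReal (b x))
        (gaussLevel (fun j _ => a * s j) c) w (fun j τ u => ENNReal.ofReal (χQ j τ u * χR j τ u))
        (fun j τ => excLevel c j (largeFieldSite (Pex j τ) (s j) (r j))) x
      ≤ (∫⁻ u : KSite R → V N, ENNReal.ofReal (Z325 R C a (0 : HiggsLattice.VecField P 0) msq
            * Real.exp (-(form325 R C a (0 : HiggsLattice.VecField P 0) msq (cfgOf R u) / 4))))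
        * ∏ j : Fin K, ∑ τ : ι j, w j τ
            * ENNReal.ofReal (Real.exp (-(gamma0 P a msq * r j * (Q j τ).card / 4))
                * Real.exp (-(gamma0 P a msq * r' j * (Rv j τ).card / 4)))
            * ENNReal.ofReal (Real.exp (-(a * r j / 8)) ^ (Pex j τ).card) := by
  have hr'' : ∀ j, 4 * (Module.finrank ℝ (V N) : ℝ) * Real.log 2 ≤ a * r j := fun j => by
    rw [finrank_V]; exact hr j
  have hX : Measurable (fun u : KSite R → V N =>
      form325 R C a (0 : HiggsLattice.VecField P 0) msq (cfgOf R u)) :=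
    (measurable_form325 (R := R) (C := C) (0 : HiggsLattice.VecField P 0) ha hL hmsq).comp (cfgOf R).measurable
  have key := ineq340_core (S := Sites R O) (ι := ι) ha hs hc hcdep hr'' r'
    (Z325_pos R C (0 : HiggsLattice.VecField P 0) ha hL hmsq).le hX (bondSet R) (massSet R)
    (fun _ bb u => bondTerm R C u bb) (fun _ xx u => siteMass R msq u xx) (fun _ bb _ u => bondTerm_nonneg u bb)
    (fun _ xx _ u => siteMass_nonneg hmsq.le u xx) (fun _ => (0 : ℝ)) (gamma0_pos ha hL hmsq.le).le hb
    (fun x _ => h326_zeroField_sites (R := R) C hR hK hε ha hL hmsq (x 0)) w Q hQ Rv hRv Pex χQ χR hχQ hχR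
    hlarge hlarge' x
  simp only [Finset.sum_const_zero, zero_div, Real.exp_zero, ENNReal.ofReal_one, one_mul] at key
  exact key

end Ineq340Zero

/-! ## §3  (3.40) with the vector-field (3.35)–(3.38) DISCHARGED on the concrete carrier -/

section Knit340

variable (R : Regions P K) (C : HiggsLattice.ChargeData N) {a msq : ℝ}
variable {O : ℕ → Type} [∀ i, Fintype (O i)] [∀ i, DecidableEq (O i)]
variable {ι : Fin K → Type*} [∀ j, Fintype (ι j)]

/-- **(3.36)–(3.38) FOR THE VECTOR FIELDS, AN EQUALITY AT ZERO FIELD**: `∫dΦ Z(0)e^{−¼⟨Φ,Δ(0)Φ⟩} = e^{½N log 2·Σ_{k=0}^{K}vol_k}·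
e^{E_{0}}` — the Jacobian of `Φ = √2Φ′` (gen 4's `h336_concrete`), (3.23)/(3.32) again (`eq337`), and the free Gaussian
integral (p28's `eq338`: `E0s P C m²` = the log of the free integral of this carrier, i.e. `E_{0,v}` for `N = d`, `m² = μ₀²`).
[cite: Balaban1982Higgs2, (3.36)–(3.38) p.591, (3.40) p.591] -/
theorem I4_zeroField_eq (ha : 0 < a) (hL : 1 < P.L) (hmsq : 0 < msq) :
    (∫ Φ : Cfg R N, Z325 R C a (0 : HiggsLattice.VecField P 0) msq
        * Real.exp (-(form325 R C a (0 : HiggsLattice.VecField P 0) msq Φ / 4)))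
      = Real.exp ((N : ℝ) * Real.log 2 / 2 * ∑ k ∈ Finset.range (K + 1), vol R k) * Real.exp (E0s P C msq) := by
  rw [h336_concrete R C (0 : HiggsLattice.VecField P 0) ha hL hmsq,
    eq337 R C (0 : HiggsLattice.VecField P 0) ha hL hmsq, B2Ineq338Diamagnetic.eq338 C hmsq]

/-- `|Λ₅⁽⁰⁾ᶜ| ≤ |T_ε|` (the k = 0 volume of (3.39) against the torus). [cite: Balaban1982Higgs2, (3.39)–(3.40) p.591] -/
theorem vol_zero_le_card : vol R 0 ≤ (Fintype.card (HiggsLattice.Site P 0) : ℝ) := by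
  simp only [vol, if_true]
  exact_mod_cast Fintype.card_subtype_le _

/-- **(3.40) AT ZERO FIELD WITH THE VECTOR-FIELD STEPS DISCHARGED**: combine `ineq340_zeroField` (the vector-field (3.35)
with ζ″, Prop. 3.1 discharged), `I4_zeroField_eq` ((3.36)–(3.38)_v exactly) and `|Λ₅⁽⁰⁾ᶜ| ≤ |T_ε|` with the bookkeeping
`B2Ineq340VectorFields.ineq340_of_321_339`: given (3.21) `lhs ≤ I_v·e^{s₂₁}`, (2.118) `s₂₁ ≤ C₁|T_ε|` and (3.39) under
the vector-field integral `I_v ≤ e^{E_{0,s}}·e^{c₃₉Σ_{k=0}^{K}vol_k}·J_v` with `J_v :=` the (finite) value of the schematic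
vector-field (3.22) over the concrete zero-field density, then `lhs ≤ Πζ″ · e^{E_{0,s}+E_{0,v}} · e^{(c₃₉+½N log 2)Σ_{k=1}^{K}vol_k}
· e^{(C₁+|c₃₉|+|½N log 2|)|T_ε|}` — (3.40) with `E₀ = E_{0,s} + E_{0,v}`, `E_{0,v} = E0s P C m²`, `O(1)`'s explicit, and
`ζ″_j = Σ_τ w_{j,τ}e^{−¼γ₀r_j|Q_v|}e^{−¼γ₀r′_j|R_v|}(e^{−⅛ar_j})^{|P_v|}` (real weights `w ≥ 0`).
[cite: Balaban1982Higgs2, (3.40)–(3.41) pp.591–592] -/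
theorem ineq340_zeroField_knit (hR : Nested R) (hK : K ≤ P.K) (hε : P.mesh K ≤ 1) (ha : 0 < a) (hL : 1 < P.L)
    (hmsq : 0 < msq) {s : ℕ → ℝ} (hs : ∀ j, 0 < s j)
    {c : (j : ℕ) → ((i : ℕ) → Sites R O i → V N) → Sites R O (j + 1) → V N} (hc : ∀ j, Measurable (c j))
    (hcdep : ∀ j i, j + 1 ≤ i → ∀ (x : (i : ℕ) → Sites R O i → V N) (y : Sites R O i → V N),
      c j (update x i y) = c j x)
    {r : ℕ → ℝ} (hr : ∀ j, 4 * (N : ℝ) * Real.log 2 ≤ a * r j) (r' : ℕ → ℝ)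
    {b : ((i : ℕ) → Sites R O i → V N) → ℝ} (hb : ∀ x, 0 ≤ b x ∧ b x ≤ 1)
    (w : (j : Fin K) → ι j → ℝ) (hw : ∀ j τ, 0 ≤ w j τ)
    (Q : (j : Fin K) → ι j → Finset (Bnd P)) (hQ : ∀ j τ, Q j τ ⊆ bondSet R j)
    (Rv : (j : Fin K) → ι j → Finset (KSite R)) (hRv : ∀ j τ, Rv j τ ⊆ massSet R j)
    (Pex : (j : Fin K) → ι j → Finset (Sites R O (j + 1)))
    (χQ χR : (j : Fin K) → ι j → (KSite R → V N) → ℝ) (hχQ : ∀ j τ u, χQ j τ u = 0 ∨ χQ j τ u = 1)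
    (hχR : ∀ j τ u, χR j τ u = 0 ∨ χR j τ u = 1)
    (hlarge : ∀ j τ u, χQ j τ u = 1 → ∀ bb ∈ Q j τ, r j < bondTerm R C u bb)
    (hlarge' : ∀ j τ u, χR j τ u = 1 → ∀ xx ∈ Rv j τ, r' j < siteMass R msq u xx)
    (x : (i : ℕ) → Sites R O i → V N)
    {lhs Iv E0s' s₂₁ C₁ c₃₉ : ℝ}
    (h321 : lhs ≤ Iv * Real.exp s₂₁) (h2118 : s₂₁ ≤ C₁ * Fintype.card (HiggsLattice.Site P 0))
    (h339 : Iv ≤ Real.exp E0s' * Real.exp (c₃₉ * ∑ k ∈ Finset.range (K + 1), vol R k)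
      * (rhs322 (fun i => (volume : Measure (Sites R O i → V N)))
          (fun u => ENNReal.ofReal (Z325 R C a (0 : HiggsLattice.VecField P 0) msq
            * Real.exp (-(form325 R C a (0 : HiggsLattice.VecField P 0) msq (cfgOf R u) / 2))))
          (fun x => ENNReal.ofReal (b x))
          (gaussLevel (fun j _ => a * s j) c) (fun j τ => ENNReal.ofReal (w j τ))
          (fun j τ u => ENNReal.ofReal (χQ j τ u * χR j τ u))
          (fun j τ => excLevel c j (largeFieldSite (Pex j τ) (s j) (r j))) x).toReal) :
    lhs ≤ (∏ j : Fin K, ∑ τ : ι j, w j τ * (Real.exp (-(gamma0 P a msq * r j * (Q j τ).card / 4))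
              * Real.exp (-(gamma0 P a msq * r' j * (Rv j τ).card / 4))) * Real.exp (-(a * r j / 8)) ^ (Pex j τ).card)
        * Real.exp (E0s' + E0s P C msq)
        * Real.exp ((c₃₉ + (N : ℝ) * Real.log 2 / 2) * ∑ k ∈ Finset.Icc 1 K, vol R k)
        * Real.exp ((C₁ + |c₃₉| + |(N : ℝ) * Real.log 2 / 2|) * Fintype.card (HiggsLattice.Site P 0)) := by
  have key := ineq340_zeroField R C hR hK hε ha hL hmsq hs hc hcdep hr r' hb (fun j τ => ENNReal.ofReal (w j τ))
    Q hQ Rv hRv Pex χQ χR hχQ hχR hlarge hlarge' x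
  set I₄ : ℝ := ∫ Φ : Cfg R N, Z325 R C a (0 : HiggsLattice.VecField P 0) msq
    * Real.exp (-(form325 R C a (0 : HiggsLattice.VecField P 0) msq Φ / 4)) with hI₄
  set Zpp : ℝ := ∏ j : Fin K, ∑ τ : ι j, w j τ * (Real.exp (-(gamma0 P a msq * r j * (Q j τ).card / 4))
    * Real.exp (-(gamma0 P a msq * r' j * (Rv j τ).card / 4))) * Real.exp (-(a * r j / 8)) ^ (Pex j τ).card with hZpp
  have hterm0 : ∀ j τ, 0 ≤ w j τ * (Real.exp (-(gamma0 P a msq * r j * (Q j τ).card / 4))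
      * Real.exp (-(gamma0 P a msq * r' j * (Rv j τ).card / 4))) * Real.exp (-(a * r j / 8)) ^ (Pex j τ).card :=
    fun j τ => by have := hw j τ; positivity
  have hZpp0 : 0 ≤ Zpp := Finset.prod_nonneg fun j _ => Finset.sum_nonneg fun τ _ => hterm0 j τ
  have hI0 : 0 ≤ I₄ :=
    integral_nonneg fun Φ => mul_nonneg (Z325_pos R C _ ha hL hmsq).le (Real.exp_pos _).le
  have hZ : (∏ j : Fin K, ∑ τ : ι j, ENNReal.ofReal (w j τ)
        * ENNReal.ofReal (Real.exp (-(gamma0 P a msq * r j * (Q j τ).card / 4))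
            * Real.exp (-(gamma0 P a msq * r' j * (Rv j τ).card / 4)))
        * ENNReal.ofReal (Real.exp (-(a * r j / 8)) ^ (Pex j τ).card)) = ENNReal.ofReal Zpp := by
    rw [hZpp, ENNReal.ofReal_prod_of_nonneg fun j _ => Finset.sum_nonneg fun τ _ => hterm0 j τ]
    refine Finset.prod_congr rfl fun j _ => ?_
    rw [ENNReal.ofReal_sum_of_nonneg fun τ _ => hterm0 j τ]
    refine Finset.sum_congr rfl fun τ _ => ?_
    rw [ENNReal.ofReal_mul (mul_nonneg (hw j τ) (by positivity)), ENNReal.ofReal_mul (hw j τ)]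
  rw [lintegral_weight4_eq R C (0 : HiggsLattice.VecField P 0) ha hL hmsq, hZ, ← hI₄,
    ← ENNReal.ofReal_mul hI0] at key
  have h4 := ENNReal.toReal_mono ENNReal.ofReal_ne_top key
  rw [ENNReal.toReal_ofReal (mul_nonneg hI0 hZpp0)] at h4
  exact ineq340_of_321_339 (K := K) (vol := vol R) hZpp0 (vol_nonneg R) (vol_zero_le_card R) h321 h2118 h339 h4
    (I4_zeroField_eq R C ha hL hmsq)

end Knit340

end Literature.MathematicalPhysics.QuantumFieldTheory.Balaban1983to89.B2Ineq340ZeroFieldConcrete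

end
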